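import Summits.ResolutionOfSingularities.ResolutionOfSingularities.Theorems.FrobeniusClosingSteerArithTransportWords
import HarnessLib

/-!
# Crux `Steer` (stmt-ResolutionOfSingularities-16345), chain W4.1, K-β0(b): the ARITHMETIC TRANSPORT WORDS v2 = UNIFORM FINE CLASS
# (`ArithTransportFine.*`; res-L0-w41-plan-1 RULINGs 315 (b) / 318 (a)(b) / 320 (b); words file, Theses-free)

OURS (campaign `res-hironaka`, rung L ★L-G4, slot W4.1). Filed by res-D-lib-1 g8 (HIRONAKA-L librarian) as the 318 (b) hand; TEXT = res-L0-w41-tri-1's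
reference v2.1 `L/res-L0-w41-tri-1/v678/ArithTransportWordsFine_reference_v21.lean` 2ff31a5900578c9a with declaration texts BYTE-IDENTICAL to the 318 (a)
reference 6ca5680e39bd4d10 (docstrings re-worded COARSE → FINE class by tri-1). The v1 B-predicates of `…ArithTransportWords` minus the slack summand
`⊔ maximalIdeal (R j) ^ (d + 2)` (with it (F-BB) v1 is refuted-as-typed locally at `d = 3`, tri-1 TRIAGE v6.67), the six visit-local words verbatim in
namespace `ArithTransportFine`, A-side names and (S-BB) from v1 `ArithTransport` by `open`. Consumed by `…ArithTransportFineInduction` (the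
p573964 / p575442 induction re-pointed, text unchanged). Definitions only; no theorem, no instance, no notation. Candidates, not facts; nothing here is a
statement of H. Hironaka's manuscript [claim: Hironaka2017, status: under-review]; AI-written, AI review is weaker than expert review. [folklore]
-/

set_option linter.dupNamespace false

open IsLocalRing
open Literature.AlgebraicGeometry.Resolution (IsRsopPart SubringDominates)
open Summit.ResolutionOfSingularities.ResolutionOfSingularities.Theorems.SwitchingDichotomy.Words
open Summit.ResolutionOfSingularities.ResolutionOfSingularities.Theorems.SwitchingDichotomy.ArithTransport
  (BinaryConeE2At AnisotropicConeAt AnisotropicImpliesE2)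

namespace Summit.ResolutionOfSingularities.ResolutionOfSingularities.Theorems.SwitchingDichotomy.ArithTransportFine

section Predicates

variable {K : Type} [Field K]

/-- **B-shape along `x`, `e = 2` · `BinaryBConeE2At`** — the B-twin, FINE CLASS (v2): `x ∈ R j` extends to an r.s.o.p.-part `(x, n₁, n₂)`, and modulo a square
the member is `x · Ψ(n₁, n₂)` for a binary form `Ψ` of degree `d` UP TO `x² · 𝔪^(d−1)` ONLY (the pollution `X²·Θ`, `deg Θ = d − 1`, of the
B-stage cone `X·Ψ̄(N) + X²·Θ` is allowed — it is what the push-forward from an A-stage produces after re-cleaning; v1's further slack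
`⊔ 𝔪^(d+2)` (p571472) is DROPPED: with it (F-BB) is locally false at `d = 3`, tri-1 TRIAGE v6.67, because a term of `𝔪^(d+2) ∖ (x²·𝔪^(d−1) + x·𝔪^(d+1))`
can carry the whole initial form after the next blow-up), with
`Ψ̄` not a scalar multiple of a `d`-th power of a linear form. The class determines the plane `⟨N̄₁, N̄₂⟩` modulo `X` and `Ψ̄` up to `GL₂(κ_j)` (reduce
mod `(X², squares)`), so «anisotropic» below is presentation-free. That `x` IS the odd divisor is carried separately (`IsBStageAt`). OURS. [folklore] -/
def BinaryBConeE2At (R : ℕ → Subring K) (s : ℕ → K) (p : ℕ) (x : K) (d j : ℕ) : Prop :=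
  ∃ (_ : IsLocalRing (R j)) (hx : x ∈ R j) (hs : s j ^ p ∈ R j) (g n₁ n₂ : R j) (Ψ : MvPolynomial (Fin 2) (R j)),
    IsRsopPart ![(⟨x, hx⟩ : R j), n₁, n₂] ∧ Ψ.IsHomogeneous d ∧
    (⟨s j ^ p, hs⟩ : R j) - g ^ 2 - ⟨x, hx⟩ * MvPolynomial.eval ![n₁, n₂] Ψ ∈
      Ideal.span {(⟨x, hx⟩ : R j) ^ 2} * maximalIdeal (R j) ^ (d - 1) ∧
    ¬ ∃ a b c : ResidueField (R j),
      MvPolynomial.map (residue (R j)) Ψ =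
        MvPolynomial.C c * (MvPolynomial.C a * MvPolynomial.X 0 + MvPolynomial.C b * MvPolynomial.X 1) ^ d

/-- **B-shape along `x`, anisotropic · `AnisotropicBConeAt`** — FINE CLASS (v2); as `BinaryBConeE2At` with «`Ψ̄` has no zero on `κ_j² ∖ 0`» in place of `e = 2`
(anisotropic ⇒ `e = 2`: `c·ℓ^d` vanishes on the kernel vector of `ℓ`). OURS. [folklore] -/
def AnisotropicBConeAt (R : ℕ → Subring K) (s : ℕ → K) (p : ℕ) (x : K) (d j : ℕ) : Prop :=
  ∃ (_ : IsLocalRing (R j)) (hx : x ∈ R j) (hs : s j ^ p ∈ R j) (g n₁ n₂ : R j) (Ψ : MvPolynomial (Fin 2) (R j)),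
    IsRsopPart ![(⟨x, hx⟩ : R j), n₁, n₂] ∧ Ψ.IsHomogeneous d ∧
    (⟨s j ^ p, hs⟩ : R j) - g ^ 2 - ⟨x, hx⟩ * MvPolynomial.eval ![n₁, n₂] Ψ ∈
      Ideal.span {(⟨x, hx⟩ : R j) ^ 2} * maximalIdeal (R j) ^ (d - 1) ∧
    ∀ a b : ResidueField (R j), (a ≠ 0 ∨ b ≠ 0) →
      MvPolynomial.eval ![a, b] (MvPolynomial.map (residue (R j)) Ψ) ≠ 0

end Predicates

section Words

open Summit.ResolutionOfSingularities.ResolutionOfSingularities.Theorems.SwitchingDichotomy (SigmaTopLegality.IsSingPrime)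

/-! ### The six visit-local words. Common header: a steered run at `p = 2` in characteristic `2` with `R 0` dominated by `O`, every member regular of
Krull dimension `4` (HYG, `ArithLeaf.arithRunHygieneTwoN_holds` p563371 ✓ by name); a visit pair `(j, j′)`, an exceptional parameter of the step at `j`
with its HΓ strip clause (HΓ = `ArithLeaf.eventuallyOnlyExcStripsTwoN_holds` p564693 ✓, late) and N4's height-one hygiene at `j′` (HYG, late) — the
exact diet of `VisitLawDelta.visitLaw₂_of_run`; `d` odd `≥ 3`. -/

/-- **(F-AB) · `BinaryBConeAfterATwoN`** — FORWARD SHAPE, A → B: at a visit pair `(j, j′)` leaving an A-STAGE `j` of cleaned order `d` with an `e = 2`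
binary cone, exceptional parameter `u`, and landing (as it must, `visitLaw₂_of_run` (3)) on a stage of cleaned order `d + 1`: the member at `j′` has the
FINE-CLASS B-shape ALONG `u` with `e = 2` (indeed in the transported pair `(m₁/u, m₂/u)` with the same `Ψ` — the near-point law for this visit is INSIDE the
proof: off the line `V(M₁/u, M₂/u)` the cleaned order at `j′` is `≤ d`). Why it might fail: see module docstring (it should not). OURS. (folklore) -/
def BinaryBConeAfterATwoN : Prop :=
  ∀ (K : Type) [Field K] [CharP K 2] (O : ValuationSubring K)
    (R : ℕ → Subring K) (P : (i : ℕ) → Ideal (R i)) (t : K) (s : ℕ → K),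
    IsSteeredRun O R P t 2 s → SubringDominates (R 0) O.toSubring →
    (∀ i, IsRegularLocalRing (R i)) → (∀ i, ringKrullDim (R i) = (4 : ℕ)) →
    ∀ (j j' : ℕ) (u : K) (d : ℕ), Odd d → 3 ≤ d → IsVisitPair R P j j' → IsExcParamAlong O (R j) (P j) u →
      (∀ l, j < l → l < j' → ∃ hu : u ∈ R l, P l = Ideal.span {(⟨u, hu⟩ : R l)}) →
      (∀ (hs' : s j' ^ 2 ∈ R j') (Q : Ideal (R j')) [Q.IsPrime], Q.height = 1 →
        ¬ SigmaTopLegality.IsSingPrime (R j') 2 ⟨s j' ^ 2, hs'⟩ Q) →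
      IsAStageAt R P s 2 j d → BinaryConeE2At R s 2 d j →
      HasCleanedOrderAt R s 2 j' (d + 1) →
      BinaryBConeE2At R s 2 u d j'

/-- **(F-BB) · `BinaryBConeAfterBTwoN`** — FORWARD SHAPE, B → B: at a visit pair `(j, j′)` leaving a B-STAGE `j` (odd divisor `x`, cleaned order `d + 1`,
fine-class `e = 2` B-shape along `x`) with exceptional parameter `u` of LARGER value than `x` (so `x/u ∈ 𝔪_{j′}` is the odd divisor at `j′`,
`visitLaw₂_of_run` (5)) and landing on a stage of cleaned order `d + 1`: the member at `j′` has the fine-class `e = 2` B-shape ALONG `x/u` (transported pair,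
same `Ψ`; off-line the cleaned order at `j′` is `≤ d`). OURS. (folklore) -/
def BinaryBConeAfterBTwoN : Prop :=
  ∀ (K : Type) [Field K] [CharP K 2] (O : ValuationSubring K)
    (R : ℕ → Subring K) (P : (i : ℕ) → Ideal (R i)) (t : K) (s : ℕ → K),
    IsSteeredRun O R P t 2 s → SubringDominates (R 0) O.toSubring →
    (∀ i, IsRegularLocalRing (R i)) → (∀ i, ringKrullDim (R i) = (4 : ℕ)) →
    ∀ (j j' : ℕ) (x u : K) (d : ℕ), Odd d → 3 ≤ d → IsVisitPair R P j j' → IsExcParamAlong O (R j) (P j) u →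
      (∀ l, j < l → l < j' → ∃ hu : u ∈ R l, P l = Ideal.span {(⟨u, hu⟩ : R l)}) →
      (∀ (hs' : s j' ^ 2 ∈ R j') (Q : Ideal (R j')) [Q.IsPrime], Q.height = 1 →
        ¬ SigmaTopLegality.IsSingPrime (R j') 2 ⟨s j' ^ 2, hs'⟩ Q) →
      IsBStageAt R P s 2 j x → HasCleanedOrderAt R s 2 j (d + 1) → BinaryBConeE2At R s 2 x d j →
      O.valuation x < O.valuation u →
      HasCleanedOrderAt R s 2 j' (d + 1) →
      BinaryBConeE2At R s 2 (x / u) d j'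

/-- **(T-R) · `ReturnIsAStageTwoN`** — TYPING AT A RETURN: at a visit pair `(j, j′)` leaving a B-STAGE `j` (odd divisor `x`, cleaned order `d + 1`, fine-class
`e = 2` B-shape along `x`) whose odd divisor `x` is ITSELF an exceptional parameter of the step (the RETURN visit, `v x` maximal on `P j`): the landing
stage has cleaned order EXACTLY `d` (the `(N₁,N₂)`-pure degree-`d` part of its cone is `Ψ̄ ≠ 0`, on-line or not — module docstring), hence — given
reduced order `d` there (hS1b) — it is an A-STAGE (no fresh odd divisor is born at a return). OURS. (folklore) -/
def ReturnIsAStageTwoN : Prop :=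
  ∀ (K : Type) [Field K] [CharP K 2] (O : ValuationSubring K)
    (R : ℕ → Subring K) (P : (i : ℕ) → Ideal (R i)) (t : K) (s : ℕ → K),
    IsSteeredRun O R P t 2 s → SubringDominates (R 0) O.toSubring →
    (∀ i, IsRegularLocalRing (R i)) → (∀ i, ringKrullDim (R i) = (4 : ℕ)) →
    ∀ (j j' : ℕ) (x : K) (d : ℕ), Odd d → 3 ≤ d → IsVisitPair R P j j' → IsExcParamAlong O (R j) (P j) x →
      (∀ l, j < l → l < j' → ∃ hx : x ∈ R l, P l = Ideal.span {(⟨x, hx⟩ : R l)}) →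
      (∀ (hs' : s j' ^ 2 ∈ R j') (Q : Ideal (R j')) [Q.IsPrime], Q.height = 1 →
        ¬ SigmaTopLegality.IsSingPrime (R j') 2 ⟨s j' ^ 2, hs'⟩ Q) →
      IsBStageAt R P s 2 j x → HasCleanedOrderAt R s 2 j (d + 1) → BinaryBConeE2At R s 2 x d j →
      HasReducedOrderAt R s 2 j' d →
      IsAStageAt R P s 2 j' d

/-- **(P-AB) · `AnisotropyPullbackABTwoN`** — PULL-BACK, A ← B: at a visit pair `(j, j′)` leaving an A-STAGE `j` (cleaned order `d`, `e = 2` binary cone)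
with exceptional parameter `u` and landing on a stage of cleaned order `d + 1` whose fine-class B-shape ALONG `u` is ANISOTROPIC (in ANY presentation): the
cone at `j` is anisotropic over `κ_j` (the two degree-`d` forms agree in `gr(R_{j′}/u)`, `e = 2` equalises the planes, and `κ_j ⊆ κ_{j′}`). OURS. (folklore) -/
def AnisotropyPullbackABTwoN : Prop :=
  ∀ (K : Type) [Field K] [CharP K 2] (O : ValuationSubring K)
    (R : ℕ → Subring K) (P : (i : ℕ) → Ideal (R i)) (t : K) (s : ℕ → K),
    IsSteeredRun O R P t 2 s → SubringDominates (R 0) O.toSubring →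
    (∀ i, IsRegularLocalRing (R i)) → (∀ i, ringKrullDim (R i) = (4 : ℕ)) →
    ∀ (j j' : ℕ) (u : K) (d : ℕ), Odd d → 3 ≤ d → IsVisitPair R P j j' → IsExcParamAlong O (R j) (P j) u →
      (∀ l, j < l → l < j' → ∃ hu : u ∈ R l, P l = Ideal.span {(⟨u, hu⟩ : R l)}) →
      (∀ (hs' : s j' ^ 2 ∈ R j') (Q : Ideal (R j')) [Q.IsPrime], Q.height = 1 →
        ¬ SigmaTopLegality.IsSingPrime (R j') 2 ⟨s j' ^ 2, hs'⟩ Q) →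
      IsAStageAt R P s 2 j d → BinaryConeE2At R s 2 d j →
      HasCleanedOrderAt R s 2 j' (d + 1) → AnisotropicBConeAt R s 2 u d j' →
      AnisotropicConeAt R s 2 d j

/-- **(P-BB) · `AnisotropyPullbackBBTwoN`** — PULL-BACK, B ← B: at a visit pair `(j, j′)` leaving a B-STAGE `j` (odd divisor `x`, cleaned order `d + 1`,
fine-class `e = 2` B-shape along `x`) with exceptional parameter `u` of larger value than `x`, landing on a stage of cleaned order `d + 1` whose fine-class B-shape
ALONG `x/u` is anisotropic: the B-shape along `x` at `j` is anisotropic (forms agree in `gr(R_{j′}/(x/u))`). OURS. (folklore) -/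
def AnisotropyPullbackBBTwoN : Prop :=
  ∀ (K : Type) [Field K] [CharP K 2] (O : ValuationSubring K)
    (R : ℕ → Subring K) (P : (i : ℕ) → Ideal (R i)) (t : K) (s : ℕ → K),
    IsSteeredRun O R P t 2 s → SubringDominates (R 0) O.toSubring →
    (∀ i, IsRegularLocalRing (R i)) → (∀ i, ringKrullDim (R i) = (4 : ℕ)) →
    ∀ (j j' : ℕ) (x u : K) (d : ℕ), Odd d → 3 ≤ d → IsVisitPair R P j j' → IsExcParamAlong O (R j) (P j) u →
      (∀ l, j < l → l < j' → ∃ hu : u ∈ R l, P l = Ideal.span {(⟨u, hu⟩ : R l)}) →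
      (∀ (hs' : s j' ^ 2 ∈ R j') (Q : Ideal (R j')) [Q.IsPrime], Q.height = 1 →
        ¬ SigmaTopLegality.IsSingPrime (R j') 2 ⟨s j' ^ 2, hs'⟩ Q) →
      IsBStageAt R P s 2 j x → HasCleanedOrderAt R s 2 j (d + 1) → BinaryBConeE2At R s 2 x d j →
      O.valuation x < O.valuation u →
      HasCleanedOrderAt R s 2 j' (d + 1) → AnisotropicBConeAt R s 2 (x / u) d j' →
      AnisotropicBConeAt R s 2 x d j

/-- **(P-BA) · `AnisotropyPullbackBATwoN`** — PULL-BACK AT A RETURN, B ← A: at a visit pair `(j, j′)` leaving a B-STAGE `j` (odd divisor `x`, cleaned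
order `d + 1`, fine-class `e = 2` B-shape along `x`) whose odd divisor `x` is itself exceptional (the return), landing on an A-STAGE of cleaned order `d`
with an anisotropic binary cone (any presentation): the B-shape along `x` at `j` is anisotropic (`R_{j′}/x` is a polynomial local ring over the field
`κ_j`; the `(N₁,N₂)`-pure degree-`d` part of the landing cone is `Ψ̄`; a translation at an off-line centre does not change it). OURS. (folklore) -/
def AnisotropyPullbackBATwoN : Prop :=
  ∀ (K : Type) [Field K] [CharP K 2] (O : ValuationSubring K)
    (R : ℕ → Subring K) (P : (i : ℕ) → Ideal (R i)) (t : K) (s : ℕ → K),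
    IsSteeredRun O R P t 2 s → SubringDominates (R 0) O.toSubring →
    (∀ i, IsRegularLocalRing (R i)) → (∀ i, ringKrullDim (R i) = (4 : ℕ)) →
    ∀ (j j' : ℕ) (x : K) (d : ℕ), Odd d → 3 ≤ d → IsVisitPair R P j j' → IsExcParamAlong O (R j) (P j) x →
      (∀ l, j < l → l < j' → ∃ hx : x ∈ R l, P l = Ideal.span {(⟨x, hx⟩ : R l)}) →
      (∀ (hs' : s j' ^ 2 ∈ R j') (Q : Ideal (R j')) [Q.IsPrime], Q.height = 1 →
        ¬ SigmaTopLegality.IsSingPrime (R j') 2 ⟨s j' ^ 2, hs'⟩ Q) →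
      IsBStageAt R P s 2 j x → HasCleanedOrderAt R s 2 j (d + 1) → BinaryBConeE2At R s 2 x d j →
      IsAStageAt R P s 2 j' d → AnisotropicConeAt R s 2 d j' →
      AnisotropicBConeAt R s 2 x d j

end Words

end Summit.ResolutionOfSingularities.ResolutionOfSingularities.Theorems.SwitchingDichotomy.ArithTransportFine
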